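import Summits.PneNP.PneNP.Theorems.ConvexRankGatesConvexGateBlindExactLiftingTriangleLine
import Summits.PneNP.PneNP.Theorems.ConvexRankGatesConvexGateBlindExactLiftingTriangle

/-!
# The line-model bound transported to the triangle instance of record `TriangleInst.triM`

Support file for crux `ConvexGateBlind` (stmt-PneNP-10680), line `xor-door-perfect-completeness`, open
stub `stub_exactLifting` (prover seat 0, session 20; memo ANALYSIS10). Lead c5's file
`…ExactLiftingTriangle.lean` records the triangle instance as `TriangleInst.triM t x w`
(`x : Fin 3 → Fin t → ZMod 2`, `w : Fin 3 → Fin t`) with its kernel-checked window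
`rk₊ ≤ 3t²`, `rk₊(M − J) = Θ(t³)`; the line-model lower bound of `…TriangleLine.lean` was proved for the
same matrix written as `monoCount` on `(Fin t → Bool)³ × (Fin t)³`. This file is the bridge
(`monoCount_pullback`) and restates the bound on `triM` verbatim (`triM_line_nmf_bound`, registered):
every decomposition `triM t − ε = ∑_{l<R} u_l ⊗ v_l + ∑_{j<q} a_j ⊗ b_j` (`ε > 0`, all factors `≥ 0`)
whose column factors `v_l` are each supported on one junta line `{w : w i = π, w i' = ρ}` satisfies
`t³ ≤ 4((⌊log₂ t⌋+1)(R + 3t²(q+1)) + 6t²)`, i.e. `R = Ω(t³ / log t)` for `q = o(t / log t)` — against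
`3t²` at `ε = 0` (`TriangleInst.coneFact_triM`) and `t³` at `ε = 1` (`TriangleInst.coneFact_triM_sub_one`).
-/

set_option linter.dupNamespace false -- `Summit.PneNP.PneNP.…`: summit = sub-problem (D-0017)

namespace Summit.PneNP.PneNP.Theorems.XorDoor.TriLine

open Finset

noncomputable section

/-- pointer triples as functions `Fin 3 → Fin t` -/
def fT {t : ℕ} (w : Tri t) : Fin 3 → Fin t :=
  fun i => if i = 0 then w.1 else if i = 1 then w.2.1 else w.2.2

/-- Boolean block colourings as `𝔽₂`-tables `Fin 3 → Fin t → ZMod 2` (`true ↦ 0`, `false ↦ 1`) -/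
def fC {t : ℕ} (x : Col t) : Fin 3 → Fin t → ZMod 2 :=
  fun i => if i = 0 then (fun a => if x.1 a then 0 else 1)
    else if i = 1 then (fun b => if x.2.1 b then 0 else 1) else (fun d => if x.2.2 d then 0 else 1)

/-- **Bridge.** `monoCount` is the pull-back of `TriangleInst.triM` along `fC`, `fT`. -/
theorem monoCount_pullback {t : ℕ} (x : Col t) (w : Tri t) :
    (monoCount x w : ℝ) = TriangleInst.triM t (fC x) (fT w) := by
  obtain ⟨x1, x2, x3⟩ := x
  obtain ⟨a, b, d⟩ := w
  have h10 : ((1 : Fin 3) = 0) = False := by decide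
  have h20 : ((2 : Fin 3) = 0) = False := by decide
  have h21 : ((2 : Fin 3) = 1) = False := by decide
  have z01 : ((0 : ZMod 2) = 1) = False := by decide
  have z10 : ((1 : ZMod 2) = 0) = False := by decide
  simp only [monoCount, TriangleInst.triM, fC, fT, if_true, h10, h20, h21, if_false]
  rcases Bool.eq_false_or_eq_true (x1 a) with h1 | h1 <;>
  rcases Bool.eq_false_or_eq_true (x2 b) with h2 | h2 <;>
  rcases Bool.eq_false_or_eq_true (x3 d) with h3 | h3 <;>
  simp [h1, h2, h3, z01, z10]

/-- **LINE-MODEL LOWER BOUND on the instance of record `TriangleInst.triM`** — registered sub-goal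
`triM_line_nmf_bound` of stmt-PneNP-10680, verbatim signature: every decomposition of `triM t − ε`
(`ε > 0`) into `R` non-negative rank-one terms with column factors supported on junta lines
`{w : w i = π ∧ w i' = ρ}` plus `q` arbitrary non-negative rank-one terms has
`t³ ≤ 4((⌊log₂ t⌋+1)(R + 3t²(q+1)) + 6t²)`. -/
theorem triM_line_nmf_bound :
    ∀ (t R q : ℕ), 2 ≤ t → ∀ (ε : ℝ), 0 < ε → ∀ (u : (Fin 3 → Fin t → ZMod 2) → Fin R → ℝ) (v : Fin R →
    (Fin 3 → Fin t) → ℝ) (a : (Fin 3 → Fin t → ZMod 2) → Fin q → ℝ) (b : Fin q → (Fin 3 → Fin t) → ℝ),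
    (∀ x l, 0 ≤ u x l) → (∀ l w, 0 ≤ v l w) → (∀ x j, 0 ≤ a x j) → (∀ j w, 0 ≤ b j w) →
    (∀ l, (∃ π ρ : Fin t, ∀ w, v l w ≠ 0 → w 0 = π ∧ w 1 = ρ) ∨ (∃ π ρ : Fin t, ∀ w, v l w ≠ 0 → w 0 = π
    ∧ w 2 = ρ) ∨ (∃ π ρ : Fin t, ∀ w, v l w ≠ 0 → w 1 = π ∧ w 2 = ρ)) →
    (∀ x w, TriangleInst.triM t x w - ε = ∑ l, u x l * v l w + ∑ j, a x j * b j w) →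
    t ^ 3 ≤ 4 * ((Nat.log 2 t + 1) * (R + 3 * t ^ 2 * (q + 1)) + 6 * t ^ 2) := by
  intro t R q ht ε hε u v a b hu hv ha hb hline hfact
  have h10 : ((1 : Fin 3) = 0) = False := by decide
  have h20 : ((2 : Fin 3) = 0) = False := by decide
  have h21 : ((2 : Fin 3) = 1) = False := by decide
  have e0 : ∀ w : Tri t, fT w 0 = w.1 := fun w => by simp [fT]
  have e1 : ∀ w : Tri t, fT w 1 = w.2.1 := fun w => by simp [fT, h10]
  have e2 : ∀ w : Tri t, fT w 2 = w.2.2 := fun w => by simp [fT, h20, h21]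
  refine triangle_line_nmf_bound' t R q ht ε hε (fun x l => u (fC x) l) (fun l w => v l (fT w))
    (fun x j => a (fC x) j) (fun j w => b j (fT w)) (fun x l => hu _ _) (fun l w => hv _ _)
    (fun x j => ha _ _) (fun j w => hb _ _) (fun l => ?_) (fun x w => ?_)
  · rcases hline l with ⟨π, ρ, h⟩ | ⟨π, ρ, h⟩ | ⟨π, ρ, h⟩
    · refine Or.inl ⟨π, ρ, fun w hw => ?_⟩
      have h' := h (fT w) hw
      rwa [e0, e1] at h'
    · refine Or.inr (Or.inl ⟨π, ρ, fun w hw => ?_⟩)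
      have h' := h (fT w) hw
      rwa [e0, e2] at h'
    · refine Or.inr (Or.inr ⟨π, ρ, fun w hw => ?_⟩)
      have h' := h (fT w) hw
      rwa [e1, e2] at h'
  · rw [monoCount_pullback]
    exact hfact _ _

end

end Summit.PneNP.PneNP.Theorems.XorDoor.TriLine
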